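import Literature.NumberTheory.EllipticCurves.BigRepUnramifiedKernelFiniteProofs
import Literature.NumberTheory.EllipticCurves.BigRepConjugationFixedFiniteProofs
import Literature.NumberTheory.EllipticCurves.CharIdealDualInfResFrameProofs
import Literature.NumberTheory.EllipticCurves.IwasawaEulerCharDualityProofs
import HarnessLib

/-!
# The local term of the big representation at a FINITELY DECOMPOSED place, FINITE CASE:
# `A^N` and `H¹(N, A)` finite ⟹ `H¹(G, T ⊗ Λ^*(Ψ⁻¹))^∨` is finitely generated, torsion, of characteristic ideal `Λ`

Topic `NumberTheory/EllipticCurves`; namespace `Literature.NumberTheory.EllipticCurves.BigGaloisRep`.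
THEOREMS ONLY (no definition, no named fact, no `sorry`). Cell `bsd-stepL`, K2 support 20495
`JSWSigmaLocalCharIdeal` (module L5 of the discharge plan; the ADDITIVE finitely decomposed places);
seat `bsd-stepL-imc-p1` g13. Assembly of the Greenberg–Vatsal frame
(`moduleFinite_isTorsion_mem_charIdeal_dual_h1_of_finite_ker_res`) with the two finite-case engines
(`finite_setOf_resSubgroup_bigRep_eq_zero`, `finite_setOf_conjMap_bigRep_eq_self`):

**`moduleFinite_isTorsion_charIdeal_eq_top_dual_h1_bigRep_of_finite`** — for a topological group `G`, a
compact normal subgroup `N` with `κ(N) = 1`, `ψ ∈ G` with `N·⟨ψ⟩` dense and `κψ ≠ 0`, and a discrete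
`p`-primary `ℤ_p`-representation `A` of `G` with `A^N` and `H¹(N, A)` FINITE, the Pontryagin dual of
`H¹(G, bigRep κ ρ)` is finitely generated and torsion over `Λ = ℤ_p⟦T⟧` with characteristic ideal `⊤`
(so it contains every `P`, in particular the Euler factor `1` of an additive place). In the application
`G = Γ_{K_w}`, `N = I_w`, `A = E[p^∞]` at an ADDITIVE place `w ∤ p` finitely decomposed in `K_∞`
(`(V_pE)^{I_w} = 0`, so both finiteness inputs hold), this is the `c ≠ 0`, `t = additive` instance of
`sigmaLocal_charIdeal_eulerFactor_mem_of_noTamagawaDefect`.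

References: [GreenbergVatsal2000] Prop. 2.4; [Skinner2016PacificMC] §2.3; [SerreLocalFields1979] XIII §1;
[Washington1997] §13.2 (finite `Λ`-modules are pseudo-null).
-/

noncomputable section

open scoped Classical Pointwise

open CategoryTheory Multiplicative

namespace Literature.NumberTheory.EllipticCurves.BigGaloisRep

open Literature.NumberTheory.GaloisRepresentations BigRepModule _root_.Subgroup

-- universe: `finite_setOf_resSubgroup_bigRep_eq_zero` places the coefficient ring `𝒪 = ℤ_p` in the
-- universe of `G` and `A`, hence `Type` here (the application `G = Γ_{K_w}`, `K : Type`, lives there).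
variable {p : ℕ} [hp : Fact p.Prime] {A : Type} [AddCommGroup A] [Module ℤ_[p] A]
  [TopologicalSpace A] [DiscreteTopology A] [ContinuousSMul ℤ_[p] A]
  {G : Type} [Group G] [TopologicalSpace G] [IsTopologicalGroup G]
  [TopologicalSpace (PowerSeries ℤ_[p])] [ContinuousSMul (PowerSeries ℤ_[p]) (BigRepModule ℤ_[p] p A)]
  (κ : G →ₜ* Multiplicative ℤ_[p]) (ρ : ContinuousRep G ℤ_[p] A) (N : Subgroup G) [N.Normal]
  [CompactSpace N]

/-- **The finitely decomposed local term, finite case** (the additive places of the local `Σ`-atom):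
`N ⊴ G` compact with `κ(N) = 1`, `N·⟨ψ⟩` dense, `κψ ≠ 0`, `A` discrete `p`-primary with `A^N` and
`H¹(N, A)` finite ⟹ `H¹(G, bigRep κ ρ)^∨` is finitely generated and torsion over `Λ`, with characteristic
ideal `⊤`: the unramified classes are finite (`finite_setOf_resSubgroup_bigRep_eq_zero`), the `ψ`-fixed
classes of `H¹(N, M)` — a `Λ`-submodule containing all restrictions — are finite
(`finite_setOf_conjMap_bigRep_eq_self`), so the frame applies with a finite `L'` (dual finite, hence
pseudo-null: `Ch = ⊤`). [cite: GreenbergVatsal2000, Prop. 2.4] [cite: Skinner2016PacificMC, §2.3 (p. 180)]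
[cite: Washington1997, §13.2] -/
theorem moduleFinite_isTorsion_charIdeal_eq_top_dual_h1_bigRep_of_finite (hκN : ∀ n ∈ N, κ n = 1)
    {ψ : G} (hψ : (κ ψ).toAdd ≠ 0) (hdense : Dense ((N : Set G) * (zpowers ψ : Set G)))
    (hA : ∀ a : A, ∃ k : ℕ, p ^ k • a = 0) [Finite (ρ.invariantsOf N)]
    [Finite (continuousCohomology 1 (subgroupRep ρ.toTopRep N))] :
    Module.Finite (IwasawaAlgebra p) (CharacterModule (continuousCohomology 1 (bigRep κ ρ).toTopRep)) ∧
      Module.IsTorsion (IwasawaAlgebra p) (CharacterModule (continuousCohomology 1 (bigRep κ ρ).toTopRep)) ∧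
      Module.charIdeal (IwasawaAlgebra p) (CharacterModule (continuousCohomology 1 (bigRep κ ρ).toTopRep)) = ⊤ := by
  set X := (bigRep κ ρ).toTopRep with hX
  -- the `ψ`-fixed classes of `H¹(N, M)`, a finite `Λ`-submodule containing the restrictions
  set L' : Submodule (IwasawaAlgebra p) (continuousCohomology 1 (subgroupRep X N)) :=
    LinearMap.ker ((conjMap X N ψ 1).hom.toLinearMap - LinearMap.id) with hL'
  have hmemL' : ∀ y, y ∈ L' ↔ conjMap X N ψ 1 y = y := fun y => by
    rw [hL', LinearMap.mem_ker, LinearMap.sub_apply, LinearMap.id_apply, sub_eq_zero]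
    rfl
  have hL'res : ∀ y, (resSubgroup X N 1).hom y ∈ L' := fun y =>
    (hmemL' _).mpr (conjMap_resSubgroup_one X N ψ y)
  haveI : Finite L' := by
    have hfin := finite_setOf_conjMap_bigRep_eq_self κ ρ N hκN hψ hA
    haveI := hfin.to_subtype
    exact Finite.of_injective (fun y : L' => (⟨y.1, (hmemL' _).mp y.2⟩ :
      {y : continuousCohomology 1 (subgroupRep X N) | conjMap X N ψ 1 y = y}))
      fun y y' h => Subtype.ext (by simpa using congrArg Subtype.val h)
  haveI : Finite (CharacterModule L') := PontryaginCard.finite_characterModule_of_finite _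
  haveI : Module.Finite (IwasawaAlgebra p) (CharacterModule L') := Module.Finite.of_finite
  have htors : Module.IsTorsion (IwasawaAlgebra p) (CharacterModule L') :=
    Module.isTorsion_of_finite_iwasawa _
  have hChL' : Module.charIdeal (IwasawaAlgebra p) (CharacterModule L') = ⊤ :=
    Module.charIdeal_eq_top_of_isPseudoNull (isPseudoNull_of_finite p (CharacterModule L'))
  -- the unramified classes are finite
  have hker := finite_setOf_resSubgroup_bigRep_eq_zero κ ρ N hκN hψ hdense
  -- the frame, with `P = 1`
  obtain ⟨hfg, hT, h1⟩ := moduleFinite_isTorsion_mem_charIdeal_dual_h1_of_finite_ker_res N (bigRep κ ρ)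
    hker L' hL'res htors (P := 1) (by rw [hChL']; exact Submodule.mem_top)
  exact ⟨hfg, hT, (Ideal.eq_top_iff_one _).mpr h1⟩

end Literature.NumberTheory.EllipticCurves.BigGaloisRep

end
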